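import Summits.QuantumFields.QCD.Theses.SpectralDefectExtinction
import Literature.MathematicalPhysics.QuantumFieldTheory.QCDPhaseQuenched
import Literature.MathematicalPhysics.QuantumLattice.GrassmannIntegralProofs

/-!
# Stub `starVertex_cancellation` of line `Sketch` (skeleton "ResolventCell") for crux
`SpectralDefectExtinction.WegnerEstimate` (item stmt-QuantumFields-8966)

Negative structural lemma N1 of the line: at a site `x` the Hermitian Wilson–Dirac operator has
the bare vertex `(m₀ + 4) Γ₅`; a frozen boundary self-energy `Ñ_y` on the two neighbours
`y = x ± 0̂` enters the Schur complement at `x` through the chiral projectors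
`P_±⁰ = (1 ± γ₀)/2` (the unitary link cancels).  With `Ñ = 1` behind `P₊⁰` and
`Ñ = (m₀ + 4)²` behind `P₋⁰` the vertex matrix

  `M = (m₀ + 4) Γ₅ - (P₊⁰ + (m₀ + 4)² P₋⁰)`

is singular for EVERY real mass `m₀`, so `x` carries a link-independent zero mode: the abstract
frozen-boundary local Wegner lemma is false on the `R = 1` cell.

Proof: with `c = m₀ + 4`, `Γ₅ = diag(1, 1, -1, -1)` (`gammaFive_eq_diagonal`) and the explicit
`γ₀ = σʸ ⊗ σˣ` (the tree's `euclideanGamma_zero`), the vector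
`v = (i (c + 1), 0, 0, 1 - c) = c Γ₅ v₋ + v₋`, `v₋ = (i, 0, 0, 1) ∈ ker (γ₀ + 1)`, satisfies
`M v = 0` entrywise and `v ≠ 0` (its first and last entries cannot vanish simultaneously), whence
`det M = 0` by `Matrix.exists_mulVec_eq_zero_iff`.
-/

namespace Summit.QuantumFields.QCD.Cruxes.WegnerEstimate.ResolventCell

open scoped Matrix BigOperators
open Literature.MathematicalPhysics.QuantumLattice Literature.MathematicalPhysics.QuantumFieldTheory
open Complex Matrix

/-- The star-vertex matrix `(m₀ + 4) Γ₅ - (P₊⁰ + (m₀ + 4)² P₋⁰)` annihilates the explicit vector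
`(i (m₀ + 5), 0, 0, -(m₀ + 3)) = c Γ₅ v₋ + v₋` with `c = m₀ + 4`, `v₋ = (i, 0, 0, 1)`,
`γ₀ v₋ = -v₋`. -/
theorem starVertex_mulVec_eq_zero (m₀ : ℝ) :
    (((m₀ + 4 : ℝ) : ℂ) • gammaFive - ((1 / 2 : ℂ) • (1 + euclideanGamma 0) +
      (((m₀ + 4) ^ 2 : ℝ) : ℂ) • ((1 / 2 : ℂ) • (1 - euclideanGamma 0)))) *ᵥ
      ![I * (((m₀ + 4 : ℝ) : ℂ) + 1), 0, 0, 1 - ((m₀ + 4 : ℝ) : ℂ)] = 0 := by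
  rw [gammaFive_eq_diagonal, euclideanGamma_zero]
  ext i
  fin_cases i
  · simp [Matrix.mulVec, dotProduct, Fin.sum_univ_four]
    ring
  · simp [Matrix.mulVec, dotProduct, Fin.sum_univ_four]
  · simp [Matrix.mulVec, dotProduct, Fin.sum_univ_four]
  · simp [Matrix.mulVec, dotProduct, Fin.sum_univ_four]
    linear_combination ((((m₀ : ℂ) + 4) ^ 2 - 1) * (((m₀ : ℂ) + 4) + 1) / 2) * Complex.I_sq

/-- The explicit kernel vector `(i (m₀ + 5), 0, 0, -(m₀ + 3))` is nonzero for every real `m₀`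
(its first entry vanishes only at `m₀ = -5`, its last only at `m₀ = -3`). -/
theorem starVertex_kernelVec_ne_zero (m₀ : ℝ) :
    (![I * (((m₀ + 4 : ℝ) : ℂ) + 1), 0, 0, 1 - ((m₀ + 4 : ℝ) : ℂ)] : Fin 4 → ℂ) ≠ 0 := by
  intro h
  have h0 := congr_fun h 0
  have h3 := congr_fun h 3
  simp [Complex.ext_iff] at h0 h3
  linarith

/-- **Star-vertex cancellation** (negative structural lemma N1 of line `Sketch`): the bare Wilson
vertex `(m₀ + 4) Γ₅` is cancelled by chirally projected neighbour self-energies for every mass —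
`det ((m₀ + 4) Γ₅ - (P₊⁰ + (m₀ + 4)² P₋⁰)) = 0` with `P_±⁰ = (1 ± γ₀)/2` — the algebraic reason
the abstract frozen-boundary local Wegner lemma fails on the `R = 1` cell / tree averaging units
fail: the site carries a link-independent zero mode `c Γ₅ v₋ + v₋`, `γ₀ v₋ = -v₋`. -/
theorem starVertex_cancellation (m₀ : ℝ) :
    (((m₀ + 4 : ℝ) : ℂ) • gammaFive - ((1 / 2 : ℂ) • (1 + euclideanGamma 0) +
      (((m₀ + 4) ^ 2 : ℝ) : ℂ) • ((1 / 2 : ℂ) • (1 - euclideanGamma 0)))).det = 0 :=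
  Matrix.exists_mulVec_eq_zero_iff.mp
    ⟨_, starVertex_kernelVec_ne_zero m₀, starVertex_mulVec_eq_zero m₀⟩

end Summit.QuantumFields.QCD.Cruxes.WegnerEstimate.ResolventCell
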